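import Summits.Schanuel.Schanuel.Theorems.RootDecomp1BAlgFrame07

/-!
# RootDecomp1BAlgFrame — lens 4, generation 40 «UNBOUNDED-DEGREE FRAMES» (lane B-R24 (b′), PRICE B-β, RULE B-R26): X(2) and the three At-cells at (1 | ρ) for every ρ in the class `AlgUltraLiouville` (doubly-exponential hyper-approximation by real algebraic irrationals of UNBOUNDED degree) modulo `Roy2014_thm_1_1` ONLY — the degree a running parameter of Roy's point-explicit L–W measure (budget lemma `algFrameMeasure_explicit_of_roy` with the floor exp(−royC D·exp(A^8)·(1+log H)) in its TYPE); the NAMED MEMBER ρ_A (a tower over 2^{1/p}, prime degrees p → ∞) with HYPOTHESIS-FREE membership, degree certificate [ℚ(β_K):ℚ] = g_K, position certificate |ρ_A − γ| ≥ exp(−A⁴) and the exclusions BY TREE NAMES (¬Hyper, ¬QuadHyper, ¬Ultra ×2, ¬LiouvilleOrder 8, transcendental) — continuation (RootDecomp1BAlgFrame08): §M.10–§M.11 position certificate + exclusions by tree names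

(lens-4 g40 HOME kernel AlgFrame.lean fe3f4606…, 1974 l, imports tree RootDecomp1BQuadFrame05 + RootDecomp1EPointTransfer04 only; CLAIM L2078, RULING + CHECKLIST B-g40 L2080, NODE L2101 / REQUEST L2102 / RESULT L2103, critic VERDICT L2111 (crit g9: (A) CLEARED — ONE CELL (B-β); lens-4 tally THEOREM ×6 + CELL ×3; RULE B-R26 in force (the Roy-transfer line on 1B CLOSED); PORT GO 01–09 `--supports stmt-Schanuel-24622`); port by census-1 gen 18 as `RootDecomp1BAlgFrame01`–`09` along K's sections: 01 = §D the class `AlgUltraLiouville` + the measure shape `AlgFrameMeasure` + §R helpers (`royC`); 02 = §R the budget lemma `algFrameMeasure_explicit_of_roy` (Roy ⟹ the algebraic frame measure in EVERY degree; scoped `maxHeartbeats 1600000` carried as in K); 03 = §E the engine `algebraicIndependent_exp_frame_of_algUltraLiouville (hRoy)` + the `![…]` forms; 04 = §M.1–§M.3 prime degrees `gdeg`, radicals `theta`, frame data `Nseq`/`Pseq`/`fd` (with `attribute [irreducible] fd`), `betaSeq`, `fSeq`, `ASeq`, growth; 05 = §M.4–§M.5 increments, the limit `rhoA`, MEMBERSHIP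 `algUltraLiouville_rhoA`; 06 = §M.6–§M.7 degree certificate `finrank_adjoin_theta` / `adjoin_betaSeq_eq` + the number-field Liouville inequality (`FK`, `thetaF`, `sigma0`, norm to ℚ); 07 = §M.8–§M.9 the frame bound, the tower inequality, scale selection, `cert_arith`; 08 = §M.10–§M.11 THE POSITION CERTIFICATE `rhoA_far_from_degree_le` + EXCLUSIONS by tree names (`not_hyperLiouville_rhoA`, `not_quadHyperLiouville_rhoA`, `not_ultraLiouville_rhoA` / `'`, `not_liouvilleOrder_rhoA`, `transcendental_rhoA`); 09 = §C the cells `four_le_polarDeg_one_of_algUltra (hRoy)` (+ swap), the At-cells, the member cells at ρ_A, `rhoA_position`.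
PORT EDITS: the three `set_option linter.*` lines dropped and the one surfaced `unnecessarySimpa` fixed (`simpa using h12` ↦ `simp`, §R); 74 one-line docstrings added; two generic helpers made `private` (`three_mul_le_two_pow`, `half_identity`) with per-part private copies of those and of K's own private helpers; statements and proofs verbatim. `--supports stmt-Schanuel-24622`; no census credit carried; rung 0 — nothing here proves Schanuel.)
-/

noncomputable section

open Complex IntermediateField MvPolynomial

namespace Summit.Schanuel.Schanuel.Theorems.RootDecomp1BAlgFrame

open Summit.Schanuel.Schanuel.Theorems.RootDecomp1EPointTransfer (Roy2014_thm_1_1)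
open Summit.Schanuel.Schanuel.Theorems.RootDecomp1KHyper (mvlen mvlen_nonneg abs_coeff_le_mvlen one_le_mvlen)
open Summit.Schanuel.Schanuel.Theorems.RootDecomp1BHyperFrame (royDeg royS RoyNF roy_tree_iff framePt Ff
  Ff_eq_aeval exists_lipschitz_Ff linearIndependent_one_irrational)
open Summit.Schanuel.Schanuel.Theorems.RootDecomp1BQuadFrame (qy qe qpt qpt_apply framePt_qy_qe linearIndependent_qpt
  QuadHyperLiouville)
open Summit.Schanuel.Schanuel.Theorems.RootDecomp1BFedFlagCore (KleinIH polarDeg polarField)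
open Summit.Schanuel.Schanuel.Theorems.RootDecomp1BDefectFloorDefs (SharpRelativeLindemannAt TameDefectZeroAt
  WildSharpDefectZeroAt WildSharpDefectZeroInitAt WildSharpInitAt)
open Summit.Schanuel.Schanuel.Theorems.RootDecomp1BDefectFloorCells (natCast_le_trdeg_of_algebraicIndependent)
open Summit.Schanuel.Schanuel.Theorems.RootDecomp1BRadicalDescent (exists_int_relation)
open Summit.Schanuel.Schanuel.Theorems.RootDecomp1BMovingZero (mem_polarField_one mem_polarField_swap)

section Member

/-- `1/(2t) = 1/t − 1/(2t)`. -/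
private theorem half_identity {t : ℝ} (ht : 0 < t) : 1 / (2 * t) = 1 / t - 1 / (2 * t) := by
  field_simp; ring

/-! ### §M.10 THE POSITION CERTIFICATE: `rhoA` is `exp(−A⁴)`-far from every algebraic real of bounded degree -/

/-- **THE CERTIFICATE.** For every degree bound `d` there is an explicit `A₀(d)` (`= a_{d+1} + 27(2d+2)²`)
such that every real root `γ` of a non-zero `h ∈ ℤ[X]` with `deg h ≤ d` and `|h_i| ≤ A`, `A ≥ A₀`, satisfies
`|rhoA − γ| ≥ exp(−A⁴)` — single-exponential, against the doubly-exponential rate `exp(−exp(A^m))` at which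
`rhoA` IS approached along the unbounded-degree frames `β_K`.  No `γ ≠ rhoA` is needed (so `rhoA` is
transcendental). -/
theorem rhoA_far_from_degree_le (d : ℕ) : ∃ A₀ : ℕ, ∀ (γ : ℝ) (h : Polynomial ℤ) (A : ℕ), A₀ ≤ A →
    h ≠ 0 → h.natDegree ≤ d → (∀ i, |h.coeff i| ≤ (A : ℤ)) → Polynomial.aeval γ h = 0 →
    Real.exp (-((A : ℝ) ^ 4)) ≤ |rhoA - γ| := by
  refine ⟨aN (d + 1) + 27 * (2 * d + 2) ^ 2, fun γ h A hA0 hh hdeg hA hγ => ?_⟩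
  have hAd : aN (d + 1) ≤ A := le_of_add_le_left hA0
  have h27 : 27 * (2 * d + 2) ^ 2 ≤ A := le_of_add_le_right hA0
  have hA1024 : 1024 ≤ A := (le_aN _).trans hAd
  have hA1 : 1 ≤ A := by omega
  obtain ⟨K, hKd, haK, hAK⟩ := exists_scale hAd
  have hdK : d < gdeg K := by have := lt_gdeg K; omega
  have hdK1 : d < gdeg (K + 1) := by have := lt_gdeg (K + 1); omega
  -- notation (naturals): `Ψ₁ = B_K^{e_K}`, `Ψ = (32 A Ψ₁)^{e_{K+1}}`
  obtain ⟨Ψ₁, hΨ₁⟩ : ∃ Ψ₁ : ℕ, Ψ₁ = (4 * aN K * A) ^ ((2 * d + 2) * (gdeg K + 1)) := ⟨_, rfl⟩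
  obtain ⟨Ψ, hΨdef⟩ : ∃ Ψ : ℕ, Ψ = (32 * A * Ψ₁) ^ ((2 * d + 2) * (gdeg (K + 1) + 1)) := ⟨_, rfl⟩
  have he2pos : 1 ≤ (2 * d + 2) * (gdeg (K + 1) + 1) := by nlinarith [lt_gdeg (K + 1)]
  have hΨ₁pos : 0 < Ψ₁ := by rw [hΨ₁]; exact Nat.pow_pos (by have := aN_pos K; nlinarith)
  have h32pos : 0 < 32 * A * Ψ₁ := by have := hΨ₁pos; nlinarith
  have hΨpos : 0 < Ψ := by rw [hΨdef]; exact Nat.pow_pos h32pos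
  have hΨ₁Ψ : Ψ₁ ≤ Ψ := by
    calc Ψ₁ ≤ 32 * A * Ψ₁ := Nat.le_mul_of_pos_left _ (by nlinarith)
      _ = (32 * A * Ψ₁) ^ 1 := (pow_one _).symm
      _ ≤ Ψ := by rw [hΨdef]; exact Nat.pow_le_pow_right h32pos he2pos
  have hΨR : (0 : ℝ) < (Ψ : ℝ) := by exact_mod_cast hΨpos
  have hΨ₁R : (0 : ℝ) < (Ψ₁ : ℝ) := by exact_mod_cast hΨ₁pos
  -- STEP 1: `|rhoA − γ| ≥ 1/(2Ψ)`, by cases on whether the level-`K` frame already resolves `γ`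
  have step1 : 1 / (2 * (Ψ : ℝ)) ≤ |rhoA - γ| := by
    rcases le_or_gt (8 * Ψ₁) (aN (K + 1)) with hc | hc
    · -- case I: `8Ψ₁ ≤ a_{K+1}`
      have hf := frame_bound hdK hh hdeg hA hA1 hγ
      have hf' : 1 / (Ψ₁ : ℝ) ≤ |betaSeq K - γ| := by rw [hΨ₁]; push_cast at hf ⊢; exact hf
      have ht := abs_rhoA_sub_betaSeq_le K
      have hcR : (8 : ℝ) * Ψ₁ ≤ aN (K + 1) := by exact_mod_cast hc
      have h4 : (4 : ℝ) / aN (K + 1) ≤ 1 / (2 * (Ψ₁ : ℝ)) := by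
        rw [div_le_div_iff₀ (aNR_pos _) (by positivity)]; linarith
      have htri := abs_sub_abs_le_abs_sub (betaSeq K - γ) (betaSeq K - rhoA)
      rw [show betaSeq K - γ - (betaSeq K - rhoA) = rhoA - γ by ring, abs_sub_comm (betaSeq K) rhoA] at htri
      have hΨcmp : 1 / (2 * (Ψ : ℝ)) ≤ 1 / (2 * (Ψ₁ : ℝ)) :=
        one_div_le_one_div_of_le (by positivity) (by exact_mod_cast Nat.mul_le_mul_left 2 hΨ₁Ψ)
      have hhalf : 1 / (2 * (Ψ₁ : ℝ)) = 1 / (Ψ₁ : ℝ) - 1 / (2 * (Ψ₁ : ℝ)) := half_identity hΨ₁R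
      calc 1 / (2 * (Ψ : ℝ)) ≤ 1 / (2 * (Ψ₁ : ℝ)) := hΨcmp
        _ = 1 / (Ψ₁ : ℝ) - 1 / (2 * (Ψ₁ : ℝ)) := hhalf
        _ ≤ |betaSeq K - γ| - |rhoA - betaSeq K| := by linarith
        _ ≤ |rhoA - γ| := htri
    · -- case II: `a_{K+1} < 8Ψ₁`: go one frame up; the tower inequality controls the tail
      have hf := frame_bound hdK1 hh hdeg hA hA1 hγ
      have hB : (4 * aN (K + 1) * A) ^ ((2 * d + 2) * (gdeg (K + 1) + 1)) ≤ Ψ := by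
        rw [hΨdef]; exact Nat.pow_le_pow_left (by nlinarith) _
      have hBpos : (0 : ℝ) < (((4 * aN (K + 1) * A : ℕ) : ℝ) ^ ((2 * d + 2) * (gdeg (K + 1) + 1))) := by
        have : 0 < 4 * aN (K + 1) * A := by have := aN_pos (K + 1); nlinarith
        positivity
      have hf' : 1 / (Ψ : ℝ) ≤ |betaSeq (K + 1) - γ| := by
        refine le_trans (one_div_le_one_div_of_le hBpos ?_) hf
        exact_mod_cast hB
      have htow : 8 * Ψ ≤ aN (K + 2) := by rw [hΨdef, hΨ₁]; exact tower hdK hAK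
      have ht := abs_rhoA_sub_betaSeq_le (K + 1)
      have hcR : (8 : ℝ) * Ψ ≤ aN (K + 2) := by exact_mod_cast htow
      have h4 : (4 : ℝ) / aN (K + 1 + 1) ≤ 1 / (2 * (Ψ : ℝ)) := by
        rw [show K + 1 + 1 = K + 2 by ring, div_le_div_iff₀ (aNR_pos _) (by positivity)]; linarith
      have htri := abs_sub_abs_le_abs_sub (betaSeq (K + 1) - γ) (betaSeq (K + 1) - rhoA)
      rw [show betaSeq (K + 1) - γ - (betaSeq (K + 1) - rhoA) = rhoA - γ by ring,
        abs_sub_comm (betaSeq (K + 1)) rhoA] at htri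
      have hhalf : 1 / (2 * (Ψ : ℝ)) = 1 / (Ψ : ℝ) - 1 / (2 * (Ψ : ℝ)) := half_identity hΨR
      calc 1 / (2 * (Ψ : ℝ)) = 1 / (Ψ : ℝ) - 1 / (2 * (Ψ : ℝ)) := hhalf
        _ ≤ |betaSeq (K + 1) - γ| - |rhoA - betaSeq (K + 1)| := by linarith
        _ ≤ |rhoA - γ| := htri
  -- STEP 2: `2Ψ ≤ A^{27 D² A²} ≤ exp(A⁴)`
  have hK11 : K + 11 ≤ A := by
    have := le_Nseq K; have := Nseq_lt_aN K; omega
  have step2 : 2 * Ψ ≤ A ^ (27 * (2 * d + 2) ^ 2 * A ^ 2) := by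
    rw [hΨdef, hΨ₁]
    exact cert_arith haK (by omega) (by omega) (by have := gdeg_le K; omega)
      (by have := gdeg_le (K + 1); omega)
  have step3 : (A : ℝ) ^ (27 * (2 * d + 2) ^ 2 * A ^ 2) ≤ Real.exp ((A : ℝ) ^ 4) := by
    have h1 : (A : ℝ) ≤ Real.exp A := by linarith [Real.add_one_le_exp (A : ℝ)]
    have h2 : ((27 * (2 * d + 2) ^ 2 * A ^ 2 : ℕ) : ℝ) * A ≤ (A : ℝ) ^ 4 := by
      have : 27 * (2 * d + 2) ^ 2 * A ^ 2 * A ≤ A ^ 4 := by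
        calc 27 * (2 * d + 2) ^ 2 * A ^ 2 * A ≤ A * A ^ 2 * A :=
              Nat.mul_le_mul (Nat.mul_le_mul h27 le_rfl) le_rfl
          _ = A ^ 4 := by ring
      exact_mod_cast this
    calc (A : ℝ) ^ (27 * (2 * d + 2) ^ 2 * A ^ 2) ≤ (Real.exp A) ^ (27 * (2 * d + 2) ^ 2 * A ^ 2) :=
          pow_le_pow_left₀ (by positivity) h1 _
      _ = Real.exp (((27 * (2 * d + 2) ^ 2 * A ^ 2 : ℕ) : ℝ) * A) := (Real.exp_nat_mul _ _).symm
      _ ≤ Real.exp ((A : ℝ) ^ 4) := Real.exp_le_exp.mpr h2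
  have step2R : 2 * (Ψ : ℝ) ≤ (A : ℝ) ^ (27 * (2 * d + 2) ^ 2 * A ^ 2) := by exact_mod_cast step2
  calc Real.exp (-((A : ℝ) ^ 4)) = 1 / Real.exp ((A : ℝ) ^ 4) := by rw [Real.exp_neg, one_div]
    _ ≤ 1 / (A : ℝ) ^ (27 * (2 * d + 2) ^ 2 * A ^ 2) := one_div_le_one_div_of_le (by positivity) step3
    _ ≤ 1 / (2 * (Ψ : ℝ)) := one_div_le_one_div_of_le (by positivity) step2R
    _ ≤ |rhoA - γ| := step1

/-! ### §M.11 EXCLUSIONS BY TREE NAMES: `rhoA` lies in none of the earlier `(1|ρ)` classes -/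

/-- `rhoA ∉ DegHyperLiouville d` for every `d`: no bounded-degree hyper-approximation. -/
theorem not_degHyperLiouville_rhoA (d : ℕ) : ¬ DegHyperLiouville d rhoA := by
  intro hdeg
  obtain ⟨A₀, hA₀⟩ := rhoA_far_from_degree_le d
  obtain ⟨γ, h, A, hmA, hh, hdh, hcoef, hroot, -, hlt⟩ := hdeg (max A₀ 4)
  have hA0 : A₀ ≤ A := (le_max_left _ _).trans hmA
  have h4 : 4 ≤ A := (le_max_right _ _).trans hmA
  have hfar := hA₀ γ h A hA0 hh hdh hcoef hroot
  have hA1 : (1 : ℝ) ≤ A := by exact_mod_cast (show 1 ≤ A by omega)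
  have hmono : Real.exp (-((A : ℝ) ^ (max A₀ 4))) ≤ Real.exp (-((A : ℝ) ^ 4)) := by
    rw [Real.exp_le_exp, neg_le_neg_iff]
    exact pow_le_pow_right₀ hA1 (le_max_right _ _)
  linarith

/-- The linear frame polynomial `den(r)·X − num(r)` of a rational `r`. -/
def ratPoly (r : ℚ) : Polynomial ℤ := Polynomial.C (r.den : ℤ) * Polynomial.X - Polynomial.C r.num

/-- The coefficients of `ratPoly r = den·X − num`. -/
theorem coeff_ratPoly (r : ℚ) (i : ℕ) :
    (ratPoly r).coeff i = if i = 1 then (r.den : ℤ) else if i = 0 then -r.num else 0 := by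
  unfold ratPoly
  rw [Polynomial.coeff_sub, Polynomial.coeff_C_mul, Polynomial.coeff_X, Polynomial.coeff_C]
  by_cases h1 : i = 1
  · subst h1; simp
  · by_cases h0 : i = 0
    · subst h0; simp
    · simp [h0, h1, Ne.symm h1]

/-- `ratPoly r ≠ 0`. -/
theorem ratPoly_ne_zero (r : ℚ) : ratPoly r ≠ 0 := by
  intro h
  have h1 : (ratPoly r).coeff 1 = (0 : Polynomial ℤ).coeff 1 := by rw [h]
  rw [coeff_ratPoly, Polynomial.coeff_zero, if_pos rfl] at h1
  have := r.den_pos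
  omega

/-- `natDegree (ratPoly r) ≤ 1`. -/
theorem natDegree_ratPoly_le (r : ℚ) : (ratPoly r).natDegree ≤ 1 := by
  unfold ratPoly
  refine (Polynomial.natDegree_sub_le _ _).trans (max_le ?_ (by rw [Polynomial.natDegree_C]; omega))
  exact (Polynomial.natDegree_C_mul_le _ _).trans Polynomial.natDegree_X_le

/-- `r` is a root of `ratPoly r`. -/
theorem aeval_ratPoly (r : ℚ) : Polynomial.aeval (r : ℝ) (ratPoly r) = 0 := by
  unfold ratPoly
  rw [map_sub, map_mul, Polynomial.aeval_C, Polynomial.aeval_X, Polynomial.aeval_C]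
  simp only [eq_intCast, Int.cast_natCast]
  have : (r : ℝ) * (r.den : ℝ) = (r.num : ℝ) := by exact_mod_cast Rat.mul_den_eq_num r
  linarith

/-- Height of the frame polynomial: `|coeff| ≤ A` as soon as `den ≤ A` and `|num| ≤ A`. -/
theorem abs_coeff_ratPoly_le (r : ℚ) {A : ℕ} (hden : r.den ≤ A) (hnum : |r.num| ≤ (A : ℤ)) (i : ℕ) :
    |(ratPoly r).coeff i| ≤ (A : ℤ) := by
  rw [coeff_ratPoly]
  split_ifs
  · rw [abs_of_nonneg (by positivity)]; exact_mod_cast hden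
  · rw [abs_neg]; exact hnum
  · simp

/-- `|num r| ≤ c · den r` when `|r| ≤ c`. -/
theorem abs_num_le (r : ℚ) {c : ℕ} (hr : |(r : ℝ)| ≤ c) : |r.num| ≤ ((c * r.den : ℕ) : ℤ) := by
  have h1 : (r : ℝ) * (r.den : ℝ) = (r.num : ℝ) := by exact_mod_cast Rat.mul_den_eq_num r
  have h2 : |(r.num : ℝ)| ≤ (c : ℝ) * r.den := by
    rw [← h1, abs_mul, abs_of_nonneg (by positivity : (0 : ℝ) ≤ r.den)]
    exact mul_le_mul_of_nonneg_right hr (by positivity)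
  have h3 : ((|r.num| : ℤ) : ℝ) ≤ (((c * r.den : ℕ) : ℤ) : ℝ) := by push_cast; exact h2
  exact_mod_cast h3

/-- LINK 1: **hyper-Liouville ⇒ degree-1 hyper-approximable** (`DegHyperLiouville 1`). -/
theorem degHyperLiouville_one_of_hyperLiouville {ρ : ℝ}
    (h : Summit.Schanuel.Schanuel.Theorems.RootDecomp1KHyper.HyperCell.HyperLiouville ρ) :
    DegHyperLiouville 1 ρ := by
  intro m
  -- `c ≥ |ρ| + 1` bounds `|r|` for every approximation `r` with `|ρ − r| < 1`
  obtain ⟨c, hc⟩ : ∃ c : ℕ, |ρ| + 1 ≤ c := ⟨⌈|ρ|⌉₊ + 1, by push_cast; linarith [Nat.le_ceil (|ρ|)]⟩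
  have hc1 : 1 ≤ c := by
    have : (1 : ℝ) ≤ c := le_trans (by linarith [abs_nonneg ρ]) hc
    exact_mod_cast this
  obtain ⟨r, hden, hne, hlt⟩ := h (2 * m + c)
  have hden1 : (1 : ℝ) ≤ r.den := by exact_mod_cast r.den_pos
  have hlt1 : |ρ - r| < 1 := by
    refine hlt.trans_le ?_
    rw [Real.exp_le_one_iff, neg_nonpos]; positivity
  have hr : |(r : ℝ)| ≤ c := by
    have := abs_sub_abs_le_abs_sub (r : ℝ) ρ
    rw [abs_sub_comm] at this
    linarith
  -- the frame: `γ = r`, `h = den·X − num`, `A = c · den`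
  refine ⟨r, ratPoly r, c * r.den, ?_, ratPoly_ne_zero r, natDegree_ratPoly_le r, ?_, aeval_ratPoly r,
    fun he => hne he.symm, ?_⟩
  · calc m ≤ 2 * m + c := by omega
      _ ≤ r.den := hden
      _ ≤ c * r.den := Nat.le_mul_of_pos_left _ hc1
  · exact abs_coeff_ratPoly_le r (Nat.le_mul_of_pos_left _ hc1) (abs_num_le r hr)
  · -- rate: `exp(−den^{2m+c}) ≤ exp(−(c den)^m)` as `den ≥ c`
    refine hlt.trans_le ?_
    rw [Real.exp_le_exp, neg_le_neg_iff]
    have hcd : c ≤ r.den := le_trans (by omega) hden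
    have key : (c * r.den) ^ m ≤ r.den ^ (2 * m + c) := by
      calc (c * r.den) ^ m ≤ (r.den * r.den) ^ m := Nat.pow_le_pow_left (Nat.mul_le_mul_right _ hcd) m
        _ = r.den ^ (2 * m) := by rw [← sq, ← pow_mul, mul_comm]
        _ ≤ r.den ^ (2 * m + c) := Nat.pow_le_pow_right r.den_pos (by omega)
    have : (((c * r.den : ℕ) : ℝ)) ^ m ≤ (r.den : ℝ) ^ (2 * m + c) := by exact_mod_cast key
    exact this

/-- LINK 2: **`QuadHyperLiouville` ⇒ degree-2 hyper-approximable** (`DegHyperLiouville 2`). -/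
theorem degHyperLiouville_two_of_quadHyperLiouville {ρ : ℝ} (h : QuadHyperLiouville ρ) :
    DegHyperLiouville 2 ρ := by
  intro m
  obtain ⟨β, a, b, c, A, hmA, -, ha, hroot, haA, hbA, hcA, hne, hlt⟩ := h m
  refine ⟨β, Polynomial.C a * Polynomial.X ^ 2 + Polynomial.C b * Polynomial.X + Polynomial.C c, A, hmA,
    ?_, ?_, ?_, ?_, hne, hlt⟩
  · intro h0
    have h2 := congrArg (fun p => p.coeff 2) h0
    simp only [Polynomial.coeff_add, Polynomial.coeff_C_mul, Polynomial.coeff_X_pow, Polynomial.coeff_X,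
      Polynomial.coeff_C, Polynomial.coeff_zero] at h2
    norm_num at h2
    exact ha h2
  · have h2 : (Polynomial.C a * Polynomial.X ^ 2 : Polynomial ℤ).natDegree ≤ 2 :=
      (Polynomial.natDegree_C_mul_le _ _).trans (Polynomial.natDegree_pow_le.trans (by
        rw [Polynomial.natDegree_X]))
    have h1 : (Polynomial.C b * Polynomial.X : Polynomial ℤ).natDegree ≤ 2 :=
      (Polynomial.natDegree_C_mul_le _ _).trans (Polynomial.natDegree_X_le.trans (by norm_num))
    have h0 : (Polynomial.C c : Polynomial ℤ).natDegree ≤ 2 := by rw [Polynomial.natDegree_C]; omega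
    exact (Polynomial.natDegree_add_le _ _).trans (max_le ((Polynomial.natDegree_add_le _ _).trans
      (max_le h2 h1)) h0)
  · intro i
    simp only [Polynomial.coeff_add, Polynomial.coeff_C_mul, Polynomial.coeff_X_pow, Polynomial.coeff_X,
      Polynomial.coeff_C]
    rcases Nat.lt_trichotomy i 1 with hi | hi | hi
    · have hi0 : i = 0 := by omega
      subst hi0; simpa using hcA
    · subst hi; simpa using hbA
    · rcases eq_or_ne i 2 with hi2 | hi2
      · subst hi2; simpa using haA
      · have hi0 : i ≠ 0 := by omega
        have hi1 : i ≠ 1 := by omega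
        simp [hi2, hi0, Ne.symm hi1]
  · rw [map_add, map_add, map_mul, map_mul, map_pow, Polynomial.aeval_X, Polynomial.aeval_C,
      Polynomial.aeval_C, Polynomial.aeval_C]
    simpa only [eq_intCast] using hroot

/-- **`rhoA` is NOT hyper-Liouville** (tree class `RootDecomp1KHyper.HyperCell.HyperLiouville`). -/
theorem not_hyperLiouville_rhoA :
    ¬ Summit.Schanuel.Schanuel.Theorems.RootDecomp1KHyper.HyperCell.HyperLiouville rhoA :=
  fun h => not_degHyperLiouville_rhoA 1 (degHyperLiouville_one_of_hyperLiouville h)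

/-- **`rhoA` is NOT in `QuadHyperLiouville`** (tree class `RootDecomp1BQuadFrame.QuadHyperLiouville`, g36). -/
theorem not_quadHyperLiouville_rhoA : ¬ QuadHyperLiouville rhoA :=
  fun h => not_degHyperLiouville_rhoA 2 (degHyperLiouville_two_of_quadHyperLiouville h)

/-- **`rhoA` is NOT ultra-Liouville** (tree class `RootDecomp1BRadicalDescent.UltraLiouville`). -/
theorem not_ultraLiouville_rhoA :
    ¬ Summit.Schanuel.Schanuel.Theorems.RootDecomp1BRadicalDescent.UltraLiouville rhoA :=
  fun h => not_hyperLiouville_rhoA h.hyperLiouville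

/-- The two tree copies of `UltraLiouville` (RadicalDescent02 l.283 / PointTransfer04 l.186) are the same text. -/
theorem ultraLiouville_iff (ρ : ℝ) :
    Summit.Schanuel.Schanuel.Theorems.RootDecomp1EPointTransfer.UltraLiouville ρ ↔
      Summit.Schanuel.Schanuel.Theorems.RootDecomp1BRadicalDescent.UltraLiouville ρ := Iff.rfl

/-- **`rhoA` is NOT ultra-Liouville** (tree class `RootDecomp1EPointTransfer.UltraLiouville`, the other copy). -/
theorem not_ultraLiouville_rhoA' :
    ¬ Summit.Schanuel.Schanuel.Theorems.RootDecomp1EPointTransfer.UltraLiouville rhoA :=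
  fun h => not_ultraLiouville_rhoA ((ultraLiouville_iff rhoA).mp h)

/-- **`rhoA` has NO exponential Liouville order `k ≥ 4`** (tree class `RootDecomp1KGeneric.LiouvilleOrder`). -/
theorem not_liouvilleOrder_rhoA {k : ℕ} (hk : 4 ≤ k) :
    ¬ Summit.Schanuel.Schanuel.Theorems.RootDecomp1KGeneric.LiouvilleOrder k rhoA := by
  intro h
  obtain ⟨A₀, hA₀⟩ := rhoA_far_from_degree_le 1
  obtain ⟨r, hden, hne, hlt⟩ := h A₀
  have hden1 : (1 : ℝ) ≤ r.den := by exact_mod_cast r.den_pos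
  -- `|r| ≤ 1`, so `A = den` bounds the frame polynomial
  have hlt1 : |rhoA - r| < 1 / 2 := by
    refine hlt.trans_le ?_
    have h1 : Real.exp (-((r.den : ℝ) ^ k)) ≤ Real.exp (-1) := by
      rw [Real.exp_le_exp, neg_le_neg_iff]; exact one_le_pow₀ hden1
    exact h1.trans Real.exp_neg_one_lt_half.le
  have hr : |(r : ℝ)| ≤ (1 : ℕ) := by
    have htri := abs_sub_abs_le_abs_sub (r : ℝ) rhoA
    rw [abs_sub_comm, abs_of_pos rhoA_pos] at htri
    have := rhoA_lt
    push_cast; linarith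
  have hnum : |r.num| ≤ ((r.den : ℕ) : ℤ) := by simpa using abs_num_le r hr
  have hfar := hA₀ r (ratPoly r) r.den hden (ratPoly_ne_zero r) (natDegree_ratPoly_le r)
    (abs_coeff_ratPoly_le r le_rfl hnum) (aeval_ratPoly r)
  have hmono : Real.exp (-((r.den : ℝ) ^ k)) ≤ Real.exp (-((r.den : ℝ) ^ 4)) := by
    rw [Real.exp_le_exp, neg_le_neg_iff]; exact pow_le_pow_right₀ hden1 hk
  linarith

/-- In particular (the order named in CHECKLIST B-g40): **no exponential Liouville order `8`**. -/
theorem not_liouvilleOrder_eight_rhoA :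
    ¬ Summit.Schanuel.Schanuel.Theorems.RootDecomp1KGeneric.LiouvilleOrder 8 rhoA :=
  not_liouvilleOrder_rhoA (by norm_num)

/-- A general coefficient bound: `|coeff_i f| ≤ Σ_j |coeff_j f|`. -/
theorem abs_coeff_le_sum_natAbs (f : Polynomial ℤ) (i : ℕ) :
    |f.coeff i| ≤ ((∑ j ∈ f.support, (f.coeff j).natAbs : ℕ) : ℤ) := by
  classical
  by_cases hi : i ∈ f.support
  · have h1 : (f.coeff i).natAbs ≤ ∑ j ∈ f.support, (f.coeff j).natAbs :=
      Finset.single_le_sum (f := fun j => (f.coeff j).natAbs) (fun j _ => Nat.zero_le _) hi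
    calc |f.coeff i| = ((f.coeff i).natAbs : ℤ) := (Int.natCast_natAbs _).symm
      _ ≤ _ := by exact_mod_cast h1
  · rw [Polynomial.notMem_support_iff.mp hi, abs_zero]; positivity

/-- **`rhoA` is transcendental over `ℤ`** (no `γ ≠ rhoA` was needed in the certificate). -/
theorem transcendental_int_rhoA : Transcendental ℤ rhoA := by
  rintro ⟨h, hh, hroot⟩
  obtain ⟨A₀, hA₀⟩ := rhoA_far_from_degree_le h.natDegree
  have hfar := hA₀ rhoA h (A₀ + ∑ j ∈ h.support, (h.coeff j).natAbs) (Nat.le_add_right _ _) hh le_rfl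
    (fun i => (abs_coeff_le_sum_natAbs h i).trans (by push_cast; linarith)) hroot
  rw [sub_self, abs_zero] at hfar
  exact absurd hfar (not_le.mpr (Real.exp_pos _))

/-- **`rhoA` is transcendental** (over `ℚ`). -/
theorem transcendental_rhoA : Transcendental ℚ rhoA :=
  fun halg => transcendental_int_rhoA ((IsFractionRing.isAlgebraic_iff ℤ ℚ ℝ).mpr halg)

end Member

end Summit.Schanuel.Schanuel.Theorems.RootDecomp1BAlgFrame

end
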